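import Mathlib
import Summits.MatrixMultiplication.MatrixMultiplication.Theses.GelfandPairHosts
import Summits.MatrixMultiplication.MatrixMultiplication.Theorems.GelfandPairHostsRankFormulaDoubleCommutant
import Summits.MatrixMultiplication.MatrixMultiplication.Theorems.GelfandPairHostsRankFormulaSpectral
import Literature.Computability.AlgebraicComplexity.FlatteningBound
import Literature.Computability.AlgebraicComplexity.KroneckerRank
import Literature.Computability.AlgebraicComplexity.AsymptoticRankZariskiClosedProofs

/-!
# `RankFormula` (route GelfandPairHosts, item stmt-MatrixMultiplication-7385)

For a finite group `G` acting on a finite set `X` write `P_g(y,x) = [g·x = y]` for the permutation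
matrices, `A = span{P_g} ⊆ ℂ^{X×X}` (`D(G,X) = dim A`), and `A'` for the `G`-invariant matrices
`B(g·x, g·y) = B(x,y)` (the commutant).  `RankFormula` says: if `A'` is commutative
(multiplicity-free permutation module) then the action tensor `T_{G,X}(y,g,x) = [g·x = y]` has
tensor rank exactly `D(G,X)`.

* Lower bound (`finrank_le_tensorRank`, flattening): the slices `g ↦ P_g` contain `D` linearly
  independent matrices, so `D ≤ R(T)` (`card_le_tensorRank_of_linearIndependent` after
  rotating / swapping the factors and restricting to those slices).
* Upper bound (`tensorRank_le_finrank`): let `(u_s)` be an orthonormal joint eigenbasis of the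
  invariant Hermitian matrices (`exists_joint_eigenbasis`; they commute by hypothesis).  Every
  invariant `B = H₁ + iH₂` (`H₁ = (B+Bᴴ)/2`, `H₂ = i(Bᴴ-B)/2` invariant Hermitian) acts on each
  `u_s` by a scalar (`exists_mulVec_eq_smul_of_invariant`), whence the rank-one matrices
  `(P_g u_s) u_s^*` commute with `A'` and lie in `A'' = A` by the double commutant theorem
  (`mem_permSpan_of_commute_invariant`); and `P_g = P_g · 1 = ∑_s (P_g u_s) u_s^*`
  (`exists_rankOne_family`).  So `A` is spanned by rank-one matrices; a basis of `A` among them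
  has `D` elements, and expanding every slice `P_g` in it writes `T_{G,X}` as a sum of `D`
  triads.  (This is the route's "`ℂ[G] → ⊕_π End V_π` acting on `⊕_π V_π`, a direct sum of
  matrix–vector tensors `⟨d_π, d_π, 1⟩`", Ceccherini-Silberstein–Scarabotti–Tolli 2018 §10.6,
  in basis-free form.)

No definitions: `P_g` and `A` are local notations for the literal expressions of the route
statement.
-/

set_option linter.dupNamespace false

noncomputable section

namespace Summit.MatrixMultiplication.MatrixMultiplication.Theorems

open scoped BigOperators ComplexOrder ComplexConjugate
open Matrix Module Literature.Computability.AlgebraicComplexity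

namespace GelfandRankFormula

variable {G : Type} [Group G] {X : Type} [DecidableEq X] [MulAction G X]

/-- `P_g`, the permutation matrix of `g` on `ℂ^X` (local notation). -/
local notation3 "𝐏[" g "]" =>
  Matrix.of fun (y : X) (x : X) => if g • x = y then (1 : ℂ) else 0

/-- `A = span{P_g}` (local notation). -/
local notation3 "𝐀" => Submodule.span ℂ (Set.range fun g : G => 𝐏[g])

variable [Fintype X]

omit [DecidableEq X] in
/-- An invariant matrix acts by a scalar on every joint eigenvector of the invariant Hermitian
matrices: write `C = H₁ + i H₂` with `H₁ = (C + Cᴴ)/2`, `H₂ = i (Cᴴ - C)/2` invariant Hermitian. -/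
theorem exists_mulVec_eq_smul_of_invariant (u : X → ℂ)
    (hu : ∀ H : Matrix X X ℂ, (∀ (g : G) (x y : X), H (g • x) (g • y) = H x y) → H.IsHermitian →
      ∃ c : ℂ, H *ᵥ u = c • u)
    (C : Matrix X X ℂ) (hC : ∀ (g : G) (x y : X), C (g • x) (g • y) = C x y) :
    ∃ μ : ℂ, C *ᵥ u = μ • u := by
  set H₁ : Matrix X X ℂ := (2 : ℂ)⁻¹ • (C + Cᴴ) with hH₁
  set H₂ : Matrix X X ℂ := ((2 : ℂ)⁻¹ * Complex.I) • (Cᴴ - C) with hH₂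
  have hCH : ∀ (g : G) (x y : X), Cᴴ (g • x) (g • y) = Cᴴ x y := by
    intro g x y
    simp only [Matrix.conjTranspose_apply, hC]
  have h1i : ∀ (g : G) (x y : X), H₁ (g • x) (g • y) = H₁ x y := by
    intro g x y
    simp only [hH₁, Matrix.smul_apply, Matrix.add_apply, hC, hCH]
  have h2i : ∀ (g : G) (x y : X), H₂ (g • x) (g • y) = H₂ x y := by
    intro g x y
    simp only [hH₂, Matrix.smul_apply, Matrix.sub_apply, hC, hCH]
  have h1h : H₁.IsHermitian := by
    have h := Matrix.isHermitian_add_transpose_self C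
    unfold Matrix.IsHermitian at h ⊢
    rw [hH₁, Matrix.conjTranspose_smul, h]
    congr 1
    simp
  have h2h : H₂.IsHermitian := by
    unfold Matrix.IsHermitian
    rw [hH₂, Matrix.conjTranspose_smul, Matrix.conjTranspose_sub, Matrix.conjTranspose_conjTranspose,
      ← neg_sub Cᴴ C, smul_neg, ← neg_smul]
    congr 1
    simp
  have hdec : C = H₁ + Complex.I • H₂ := by
    rw [hH₁, hH₂, smul_smul]
    have hI : Complex.I * ((2 : ℂ)⁻¹ * Complex.I) = -(2 : ℂ)⁻¹ := by
      rw [mul_left_comm, Complex.I_mul_I]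
      ring
    rw [hI]
    module
  obtain ⟨c₁, hc₁⟩ := hu H₁ h1i h1h
  obtain ⟨c₂, hc₂⟩ := hu H₂ h2i h2h
  refine ⟨c₁ + Complex.I * c₂, ?_⟩
  rw [hdec, Matrix.add_mulVec, Matrix.smul_mulVec Complex.I H₂ u, hc₁, hc₂, smul_smul, ← add_smul]

variable [Fintype G]

/-- Under multiplicity-freeness, `A = span{P_g}` contains the rank-one matrices
`(P_g u_s) u_s^*` for a joint eigenbasis `(u_s)` of the invariant Hermitian matrices, and
`P_g = ∑_s (P_g u_s) u_s^*`. -/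
theorem exists_rankOne_family
    (hmf : ∀ A B : Matrix X X ℂ, (∀ (g : G) (x y : X), A (g • x) (g • y) = A x y) →
      (∀ (g : G) (x y : X), B (g • x) (g • y) = B x y) → A * B = B * A) :
    ∃ (ι : Type) (_ : Fintype ι) (u : ι → X → ℂ),
      (∀ (g : G) (s : ι), Matrix.vecMulVec (𝐏[g] *ᵥ u s) (star (u s)) ∈ 𝐀) ∧
      (∀ g : G, 𝐏[g] = ∑ s, Matrix.vecMulVec (𝐏[g] *ᵥ u s) (star (u s))) := by
  classical
  -- the commuting family of invariant Hermitian matrices and its joint eigenbasis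
  set S : Set (Matrix X X ℂ) :=
    {H | (∀ (g : G) (x y : X), H (g • x) (g • y) = H x y) ∧ H.IsHermitian} with hSdef
  obtain ⟨ι, _, u, χ, hsum, hunit, heig⟩ := exists_joint_eigenbasis S (fun H hH => hH.2)
    (fun H hH H' hH' => hmf H H' hH.1 hH'.1)
  refine ⟨ι, inferInstance, u, ?_, ?_⟩
  swap
  · intro g
    conv_lhs => rw [← Matrix.mul_one (𝐏[g]), ← hsum]
    rw [Finset.mul_sum]
    exact Finset.sum_congr rfl fun s _ => Matrix.mul_vecMulVec _ _ _
  intro g s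
  apply mem_permSpan_of_commute_invariant
  intro B hB
  have hu : ∀ H : Matrix X X ℂ, (∀ (g : G) (x y : X), H (g • x) (g • y) = H x y) →
      H.IsHermitian → ∃ c : ℂ, H *ᵥ u s = c • u s :=
    fun H hHi hHh => ⟨χ s H, heig s H ⟨hHi, hHh⟩⟩
  obtain ⟨μ, hμ⟩ := exists_mulVec_eq_smul_of_invariant (u s) hu B hB
  have hBH : ∀ (g : G) (x y : X), Bᴴ (g • x) (g • y) = Bᴴ x y := fun g x y => by
    simp only [Matrix.conjTranspose_apply, hB]
  obtain ⟨μ', hμ'⟩ := exists_mulVec_eq_smul_of_invariant (u s) hu Bᴴ hBH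
  have hvB : star (u s) ᵥ* B = star (Bᴴ *ᵥ u s) := by
    rw [Matrix.star_mulVec, Matrix.conjTranspose_conjTranspose]
  -- `star μ' = μ`, testing against the unit vector `u s`
  have hμμ' : star μ' = μ := by
    have h1 : star (u s) ⬝ᵥ (B *ᵥ u s) = μ := by
      rw [hμ, dotProduct_smul, hunit, smul_eq_mul, mul_one]
    have h2 : star (u s) ⬝ᵥ (B *ᵥ u s) = star μ' := by
      rw [Matrix.dotProduct_mulVec, hvB, hμ', star_smul, smul_dotProduct, hunit, smul_eq_mul,
        mul_one]
    rw [← h2, h1]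
  have h3 : star (u s) ᵥ* B = μ • star (u s) := by
    rw [hvB, hμ', star_smul, hμμ']
  rw [Matrix.mul_vecMulVec, Matrix.vecMulVec_mul, Matrix.mulVec_mulVec,
    ← permMat_mul_eq_of_invariant hB g, ← Matrix.mulVec_mulVec, hμ, Matrix.mulVec_smul, h3,
    Matrix.smul_vecMulVec, Matrix.vecMulVec_smul]

/-- **Upper bound** `R(T_{G,X}) ≤ D(G,X)`: `A` has a basis of `D` rank-one matrices, and
expanding each slice `P_g` in it writes `T_{G,X}` as a sum of `D` triads. -/
theorem tensorRank_le_finrank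
    (hmf : ∀ A B : Matrix X X ℂ, (∀ (g : G) (x y : X), A (g • x) (g • y) = A x y) →
      (∀ (g : G) (x y : X), B (g • x) (g • y) = B x y) → A * B = B * A) :
    tensorRank (fun (y : X) (g : G) (x : X) => if g • x = y then (1 : ℂ) else 0) ≤
      Module.finrank ℂ 𝐀 := by
  classical
  obtain ⟨ι, _, u, hmem, hexp⟩ := exists_rankOne_family hmf
  -- the rank-one family spans `A`
  set R : Set (Matrix X X ℂ) :=
    Set.range fun p : G × ι => Matrix.vecMulVec (𝐏[p.1] *ᵥ u p.2) (star (u p.2)) with hR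
  have hRA : Submodule.span ℂ R = 𝐀 := by
    apply le_antisymm
    · rw [Submodule.span_le]
      rintro _ ⟨p, rfl⟩
      exact hmem p.1 p.2
    · rw [Submodule.span_le]
      rintro _ ⟨g, rfl⟩
      show 𝐏[g] ∈ Submodule.span ℂ R
      rw [hexp g]
      exact Submodule.sum_mem _ fun s _ => Submodule.subset_span ⟨(g, s), rfl⟩
  -- a basis of `A` inside the family
  obtain ⟨b, hbR, hbspan, hbli⟩ := exists_linearIndependent ℂ R
  have hbfin : b.Finite := (Set.finite_range _).subset hbR
  letI : Fintype b := hbfin.fintype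
  have hcard : Fintype.card b = Module.finrank ℂ 𝐀 := by
    rw [← hRA, ← hbspan, finrank_span_set_eq_card hbli, Set.toFinset_card]
  have hpick : ∀ M : b, ∃ p : G × ι,
      Matrix.vecMulVec (𝐏[p.1] *ᵥ u p.2) (star (u p.2)) = M.1 := fun M => hbR M.2
  choose pick hpick using hpick
  -- coordinates of the slices `P_g` in the basis
  have hcoord : ∀ g : G, ∃ c : b → ℂ, ∑ M, c M • (M.1 : Matrix X X ℂ) = 𝐏[g] := by
    intro g
    have hg : 𝐏[g] ∈ Submodule.span ℂ (Set.range (Subtype.val : b → Matrix X X ℂ)) := by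
      rw [Subtype.range_coe, hbspan, hRA]
      exact permMat_mem g
    exact (Submodule.mem_span_range_iff_exists_fun ℂ).1 hg
  choose c hc using hcoord
  rw [← hcard]
  refine tensorRank_le_card_of_eq_sum (fun M y => (𝐏[(pick M).1] *ᵥ u (pick M).2) y)
    (fun M g => c g M) (fun M x => star (u (pick M).2 x)) ?_
  funext y g x
  have h := congr_fun (congr_fun (hc g) y) x
  rw [Matrix.sum_apply] at h
  simp only [Matrix.smul_apply, smul_eq_mul] at h
  rw [Finset.sum_apply, Finset.sum_apply, Finset.sum_apply]
  rw [show (if g • x = y then (1 : ℂ) else 0) = (𝐏[g]) y x from rfl, ← h]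
  refine Finset.sum_congr rfl fun M _ => ?_
  rw [triad_apply, ← hpick M, Matrix.vecMulVec_apply, Pi.star_apply]
  ring

omit [Fintype G] in
/-- **Lower bound** `D(G,X) ≤ R(T_{G,X})` (flattening): the slices `g ↦ P_g` of `T_{G,X}` contain
`D = dim span{P_g}` linearly independent ones. -/
theorem finrank_le_tensorRank [Fintype G] :
    Module.finrank ℂ 𝐀 ≤
      tensorRank (fun (y : X) (g : G) (x : X) => if g • x = y then (1 : ℂ) else 0) := by
  classical
  obtain ⟨b, hbR, hbspan, hbli⟩ := exists_linearIndependent ℂ (Set.range fun g : G => 𝐏[g])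
  have hbfin : b.Finite := (Set.finite_range _).subset hbR
  letI : Fintype b := hbfin.fintype
  have hcard : Fintype.card b = Module.finrank ℂ 𝐀 := by
    rw [← hbspan, finrank_span_set_eq_card hbli, Set.toFinset_card]
  have hpick : ∀ M : b, ∃ g : G, 𝐏[g] = M.1 := fun M => hbR M.2
  choose gof hgof using hpick
  -- the sub-tensor with the independent slices
  set t' : b → X → X → ℂ := fun M y x => if gof M • x = y then (1 : ℂ) else 0 with ht'
  have hli' : LinearIndependent ℂ (fun M => t' M : b → X → X → ℂ) := by
    have e : (fun M => t' M) = fun M : b => (M.1 : X → X → ℂ) := by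
      funext M
      exact hgof M
    rw [e]
    exact hbli
  calc Module.finrank ℂ 𝐀 = Fintype.card b := hcard.symm
    _ ≤ tensorRank t' := card_le_tensorRank_of_linearIndependent t' hli'
    _ ≤ tensorRank (fun (g : G) (y : X) (x : X) => if g • x = y then (1 : ℂ) else 0) :=
        tensorRank_le_of_eq_precomp _ gof id id t' (fun M y x => rfl)
    _ = tensorRank (fun (y : X) (g : G) (x : X) => if g • x = y then (1 : ℂ) else 0) := by
        rw [← tensorRank_rotate (fun (y : X) (g : G) (x : X) => if g • x = y then (1 : ℂ) else 0),
          ← tensorRank_swap₂₃ (rotate _)]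
        rfl

end GelfandRankFormula

/-- **`RankFormula`** (route GelfandPairHosts, item stmt-MatrixMultiplication-7385): for a
multiplicity-free finite `G`-set `X` (commutative commutant) the action tensor
`T_{G,X}(y,g,x) = [g·x = y]` has tensor rank exactly `D(G,X) = dim span{P_g}`. -/
theorem rankFormula_proof :
    Summit.MatrixMultiplication.MatrixMultiplication.Theses.GelfandPairHosts.RankFormula := by
  intro G _ _ X _ _ _ hmf
  exact le_antisymm (GelfandRankFormula.tensorRank_le_finrank hmf)
    GelfandRankFormula.finrank_le_tensorRank

end Summit.MatrixMultiplication.MatrixMultiplication.Theorems
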